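import Mathlib
import Literature.NumberTheory.LFunctions.Zhang2022.RepairBedLenxClosedForms
import Literature.NumberTheory.LFunctions.Zhang2022.KnifeEdgeOffDiagForm
import HarnessLib

/-!
# Zhang (2022), rescue bed (D-0124 (3)) node D130-4 «U-a θ > 1 tops: the sign question», MODEL side: the registered
# in-class taper `u_T(x) = (1 − x)⁺`, its atoms `𝔅(u_T) = 8/π + 52π/3`, `L(u_T) = −12 + 12πi`, and the X = 0 closing
# criterion of the two registered two-piece designs `u_T ⊕ s·v_J`, `u_T ⊕ s·φ_θ` in closed form — the kernel twin
# of bed-7's model table (spec `bed7-Ua-sign-v0.1` §2, prediction SP2 «kernel fact, printed not measured»)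

Topic `Literature/NumberTheory/LFunctions/Zhang2022` (Landau–Siegel audit tree; verdict-neutral).
Y. Zhang, *Discrete mean estimates and the Landau–Siegel zero*, arXiv:2211.02515v1 (2022) [Zhang2022LandauSiegel] —
**an unrefereed manuscript under adjudication; nothing here asserts or denies any of its claims, and nothing here is
a claim about Landau–Siegel zeros.**

Companion of `RepairBedLenxModel` / `RepairBedLenxClosedForms` (the overhang side: `Φ_J = h²/2`, `Φ_A = h³/6`,
`Re 𝔅_θ(v_J) = 8h/π + 52πh³/3`, `Re 𝔅_θ(φ_θ) = 8h³/(3π) + 44πh⁵/15`, `h = θ − 1`) and of `KnifeEdgeOffDiagForm`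
(the two-piece bookkeeping `twoPieceMainTerm θ X u u′ v v′ s = |s|²𝔅(u) + 2Re(s·c) + k`, `closes_iff_of_pos`:
`𝔅(u) > 0 ⇒ ((∃ s, q < 0) ↔ k·𝔅(u) < |c|²)`). The bed's registered IN-CLASS piece is the taper
`u_T(x) = (1 − x)⁺` (coefficients `1 − log n/log P` on `n < P`); this file records, as theorems of the continued
calculus at `X = 0`,

* Part 1 — the taper: `taperProfile`, `taperProfile'`, `inClassPiece_taperProfile` (it IS an in-class piece),
  `integral_taperProfile` (`∫₀¹ u_T = 1/2`), **`tailFunctional_taperProfile`** (`L(u_T) = −12 + 12πi`),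
  **`mainTermForm_taperProfile`** (`𝔅(u_T) = 8/π + 52π/3` — the closed form of the bed's three-lineage numeric value
  of record `57.000751751693…`; it coincides with `Re 𝔅_θ(v_J)` at `h = 1`), `mainTermForm_taperProfile_window`;
* Part 2 — the cross atoms: `tailCoupling` of the taper with the jump / with `φ_θ` and their squared norms
  `36π²(1+π²)h⁴` / `4π²(1+π²)h⁶`;
* Part 3 — **the X = 0 closing criterion in closed form** (`taper_jump_closes_iff`, `taper_phiT_closes_iff`):
  `(∃ s, twoPieceMainTerm θ 0 u_T u_T′ v_J v_J′ s < 0) ↔ (8h/π + 52πh³/3)(8/π + 52π/3) < 36π²(1+π²)h⁴`, and for the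
  arch `(8h³/(3π) + 44πh⁵/15)(8/π + 52π/3) < 4π²(1+π²)h⁶`;
* Part 4 — **the registered sign table** (bed-7 SP2): the jump design closes at `θ = 2` and `θ = 3` and does not
  close at `θ = 5/4`, `3/2`; the arch design closes at `θ = 3` and does not close at `5/4`, `3/2`, `2`;
* Part 5 — **the thresholds `θ*` as kernel windows**: the closing sets are up-sets in `θ` (`taper_jump_closes_mono`,
  `taper_phiT_closes_mono`) and `1.855 < θ*_J < 1.856`, `2.291 < θ*_A < 2.292` in the form «no closing at
  `θ ≤ 1.855` / `θ ≤ 2.291`, closing at `θ ≥ 1.856` / `θ ≥ 2.292`» (bed-7 printed `θ*_J = 1.8551`, `θ*_A = 2.2917`);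
* Part 6 — the kernel-mode rows `u_K = g⋆` (`𝔅(g⋆) = 0`): `gStar_jump_closes`, `gStar_phiT_closes` — at X = 0 the
  design `g⋆ ⊕ s·v` closes at every `θ > 1` (`c₀ = 24πΦ_v ≠ 0`, `closes_iff_of_zero`); the sizes and the currency
  windows `C*`, `C_req` of the taper designs are in the companion `RepairBedUaSignCurrencies`.

Caveat as in the kit: `M_θ`, `θ > 1`, is formula I's calculus CONTINUED past `P`, not a proved main term; «closes at
X = 0» is a statement about that continued quadratic, not about any genuine mean value. Nothing here evaluates a
genuine block, touches a registered word, or asserts an off-diagonal input. Theorems only; no `instance`, no notation.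

## References

* Y. Zhang, arXiv:2211.02515v1 (2022), §7 Prop 7.1, (7.2) p.44; §8 (8.11)–(8.12). [cite: Zhang2022LandauSiegel, §§7, 8]
-/

noncomputable section

open Complex Real ComplexConjugate Set intervalIntegral
open _root_.MeasureTheory

namespace Literature.NumberTheory.LFunctions.Zhang2022.Repair.Bed

open KnifeEdge

/-! ### Part 1 — the registered in-class taper `u_T(x) = (1 − x)⁺` and its atoms -/

section Taper

/-- The bed's registered in-class piece `u_T(x) = (1 − x)⁺`: coefficients `1 − log n/log P` on `n < P`, nothing at or
beyond the wall. [cite: Zhang2022LandauSiegel, §7 (7.2) p.44] -/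
def taperProfile (x : ℝ) : ℂ := (((max (1 - x) 0 : ℝ)) : ℂ)

/-- The companion (right) derivative of the taper: `−1` below the wall, `0` at and beyond it.
[cite: Zhang2022LandauSiegel, §7 (7.2) p.44] -/
def taperProfile' (x : ℝ) : ℂ := if x < 1 then -1 else 0

/-- `u_T(x) = 1 − x` for `x ≤ 1`. [cite: Zhang2022LandauSiegel, §7 (7.2) p.44] -/
theorem taperProfile_of_le_one {x : ℝ} (hx : x ≤ 1) : taperProfile x = (((1 - x : ℝ)) : ℂ) := by
  rw [taperProfile, max_eq_left (by linarith)]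

/-- `u_T(x) = 0` for `x ≥ 1`. [cite: Zhang2022LandauSiegel, §7 (7.2) p.44] -/
theorem taperProfile_of_one_le {x : ℝ} (hx : 1 ≤ x) : taperProfile x = 0 := by
  rw [taperProfile, max_eq_right (by linarith)]
  push_cast
  ring

/-- `u_T(0) = 1`. [cite: Zhang2022LandauSiegel, §7 (7.2) p.44] -/
theorem taperProfile_zero : taperProfile 0 = 1 := by
  rw [taperProfile_of_le_one zero_le_one]
  push_cast
  ring

/-- `u_T(1) = 0` (the taper vanishes at the wall). [cite: Zhang2022LandauSiegel, §7 (7.2) p.44] -/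
theorem taperProfile_one : taperProfile 1 = 0 := taperProfile_of_one_le le_rfl

/-- `u_T′(x) = −1` for `x < 1`. [cite: Zhang2022LandauSiegel, §7 (7.2) p.44] -/
theorem taperProfile'_of_lt_one {x : ℝ} (hx : x < 1) : taperProfile' x = -1 := by
  rw [taperProfile', if_pos hx]

/-- `u_T′(x) = 0` for `x ≥ 1`. [cite: Zhang2022LandauSiegel, §7 (7.2) p.44] -/
theorem taperProfile'_of_one_le {x : ℝ} (hx : 1 ≤ x) : taperProfile' x = 0 := by
  rw [taperProfile', if_neg (not_lt.2 hx)]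

/-- **The taper is an in-class piece** (`KnifeEdge.InClassPiece`: kinked `H¹` on `[0,1]`, vanishing with its
companion derivative on `[1, ∞)`), so `closes_iff`, `rankOneTailCoupling_holds` and the rough coupling with `v_J`
apply to the registered design verbatim. [cite: Zhang2022LandauSiegel, Prop 7.1 p.44, (7.2)] -/
theorem inClassPiece_taperProfile : InClassPiece taperProfile taperProfile' where
  kinked :=
    { cont := (Complex.continuous_ofReal.comp
        ((continuous_const.sub continuous_id).max continuous_const)).continuousOn
      hasDeriv := fun x hx => by
        have h1 : HasDerivAt (fun t : ℝ => (((1 - t : ℝ)) : ℂ)) ((((0 - 1 : ℝ)) : ℂ)) x :=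
          ((hasDerivAt_const x (1:ℝ)).sub (hasDerivAt_id x)).ofReal_comp
        have e : (((0 - 1 : ℝ)) : ℂ) = -1 := by push_cast; ring
        rw [e] at h1
        have h2 : HasDerivAt taperProfile (-1) x := by
          refine h1.congr_of_eventuallyEq ?_
          filter_upwards [Iio_mem_nhds hx.2] with t ht using taperProfile_of_le_one (le_of_lt ht)
        rw [taperProfile'_of_lt_one hx.2]
        exact h2.hasDerivWithinAt
      memLp := by
        refine MemLp.of_bound (Measurable.ite measurableSet_Iio measurable_const
          measurable_const).aestronglyMeasurable 1 (Filter.Eventually.of_forall fun t => ?_)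
        unfold taperProfile'
        split_ifs <;> simp }
  vanish := fun y hy => taperProfile_of_one_le hy
  vanish' := fun y hy => taperProfile'_of_one_le hy

/-- `∫₀¹ u_T = 1/2`. [cite: Zhang2022LandauSiegel, Prop 7.1 p.44, (7.2)] -/
theorem integral_taperProfile : ∫ t in (0:ℝ)..1, taperProfile t = (((1 / 2 : ℝ)) : ℂ) := by
  rw [intervalIntegral.integral_congr (g := fun t => (((1 - t : ℝ)) : ℂ)) (fun t ht => by
      rw [uIcc_of_le zero_le_one] at ht
      exact taperProfile_of_le_one ht.2),
    intervalIntegral.integral_ofReal, intervalIntegral.integral_sub intervalIntegrable_const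
      intervalIntegral.intervalIntegrable_id, intervalIntegral.integral_const, integral_id, smul_eq_mul]
  push_cast
  ring

/-- **`L(u_T) = −12 + 12πi`**: the taper's Dirichlet-tail functional (`12(u(1) − u(0)) + 24πi∫₀¹u` with `u(1) = 0`,
`u(0) = 1`, `∫u = 1/2`); `|L(u_T)|² = 144(1 + π²)`. [cite: Zhang2022LandauSiegel, Prop 7.1 p.44, (8.11)–(8.12)] -/
theorem tailFunctional_taperProfile : tailFunctional taperProfile = -12 + 12 * (π : ℂ) * I := by
  rw [tailFunctional, integral_taperProfile, taperProfile_one, taperProfile_zero]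
  push_cast
  ring

/-- `∫₀¹ |u_T′|² = 1`. [cite: Zhang2022LandauSiegel, Prop 7.1 p.44, (7.2)] -/
theorem integral_norm_sq_taperProfile' : ∫ x in (0:ℝ)..1, ‖taperProfile' x‖ ^ 2 = 1 := by
  rw [intervalIntegral.integral_congr_Ioo_of_le zero_le_one (g := fun _ => (1:ℝ)) (fun x hx => by
      show ‖taperProfile' x‖ ^ 2 = 1
      rw [taperProfile'_of_lt_one hx.2, norm_neg, norm_one, one_pow]),
    intervalIntegral.integral_const, smul_eq_mul]
  ring

/-- `∫₀¹ |u_T|² = 1/3`. [cite: Zhang2022LandauSiegel, Prop 7.1 p.44, (7.2)] -/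
theorem integral_norm_sq_taperProfile : ∫ x in (0:ℝ)..1, ‖taperProfile x‖ ^ 2 = 1 / 3 := by
  rw [intervalIntegral.integral_congr_Ioo_of_le zero_le_one (g := fun x => (1 - x) ^ 2) (fun x hx => by
      show ‖taperProfile x‖ ^ 2 = (1 - x) ^ 2
      rw [taperProfile_of_le_one hx.2.le, Complex.norm_real, Real.norm_eq_abs, sq_abs])]
  have h := intervalIntegral.integral_comp_sub_left (fun x : ℝ => x ^ 2) (1:ℝ) (a := 0) (b := 1)
  simp only [sub_self, sub_zero] at h
  rw [h, integral_pow]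
  norm_num

/-- `Im ∫₀¹ u_T′·conj u_T = 0` (real data). [cite: Zhang2022LandauSiegel, Prop 7.1 p.44, (7.2)] -/
theorem integral_taperProfile'_mul_conj_im :
    (∫ x in (0:ℝ)..1, taperProfile' x * conj (taperProfile x)).im = 0 := by
  rw [intervalIntegral.integral_congr_Ioo_of_le zero_le_one (g := fun x => (((-(1 - x) : ℝ)) : ℂ))
      (fun x hx => by
        show taperProfile' x * conj (taperProfile x) = (((-(1 - x) : ℝ)) : ℂ)
        rw [taperProfile'_of_lt_one hx.2, taperProfile_of_le_one hx.2.le, Complex.conj_ofReal]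
        push_cast
        ring),
    intervalIntegral.integral_ofReal, Complex.ofReal_im]

/-- `Im ∫₀¹ u_T·conj(∫₀ˣ u_T) = 0` (real data). [cite: Zhang2022LandauSiegel, Prop 7.1 p.44, (7.2)] -/
theorem integral_taperProfile_mul_conj_primitive_im :
    (∫ x in (0:ℝ)..1, taperProfile x * conj (∫ t in (0:ℝ)..x, taperProfile t)).im = 0 := by
  rw [intervalIntegral.integral_congr_Ioo_of_le zero_le_one
      (g := fun x => ((((1 - x) * ∫ t in (0:ℝ)..x, (1 - t) : ℝ)) : ℂ))
      (fun x hx => by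
        show taperProfile x * conj (∫ t in (0:ℝ)..x, taperProfile t) = ((((1 - x) * ∫ t in (0:ℝ)..x, (1 - t) : ℝ)) : ℂ)
        have hi : ∫ t in (0:ℝ)..x, taperProfile t = ∫ t in (0:ℝ)..x, (((1 - t : ℝ)) : ℂ) :=
          intervalIntegral.integral_congr fun t ht => by
            rw [uIcc_of_le hx.1.le] at ht
            exact taperProfile_of_le_one (ht.2.trans hx.2.le)
        rw [hi, intervalIntegral.integral_ofReal, Complex.conj_ofReal, taperProfile_of_le_one hx.2.le]
        push_cast
        ring),
    intervalIntegral.integral_ofReal, Complex.ofReal_im]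

/-- **`𝔅(u_T) = 8/π + 52π/3`** (`= 57.000751751693…`, the bed's three-lineage numeric value of record for the
in-class taper, now a closed form of `mainTermForm_eq`: `(8/π)·1 + 88π·(1/3) − 24π·(1/2)`, the three `Im`-terms
vanish on real data; note `𝔅(u_T) = Re 𝔅_θ(v_J)|_{θ = 2}`). [cite: Zhang2022LandauSiegel, Prop 7.1 p.44, (7.2)] -/
theorem mainTermForm_taperProfile : mainTermForm taperProfile taperProfile' = 8 / π + 52 / 3 * π := by
  rw [mainTermForm_eq, integral_norm_sq_taperProfile', integral_taperProfile'_mul_conj_im,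
    integral_norm_sq_taperProfile, integral_taperProfile_mul_conj_primitive_im, integral_taperProfile,
    taperProfile_zero, taperProfile_one, Complex.conj_ofReal]
  simp only [map_zero, mul_zero, Complex.zero_im, add_zero, mul_one, Complex.ofReal_re]
  ring

/-- `𝔅(u_T) > 0` (so the `X`-pricing row `closes_iff_of_pos` applies to every design `u_T ⊕ s·v`).
[cite: Zhang2022LandauSiegel, Prop 7.1 p.44, (7.2)] -/
theorem mainTermForm_taperProfile_pos : 0 < mainTermForm taperProfile taperProfile' := by
  rw [mainTermForm_taperProfile]
  positivity

/-- Kernel window for the printed value: `57.0007 < 𝔅(u_T) < 57.0008`. [cite: Zhang2022LandauSiegel, Prop 7.1 p.44, (7.2)] -/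
theorem mainTermForm_taperProfile_window :
    57.0007 < mainTermForm taperProfile taperProfile' ∧ mainTermForm taperProfile taperProfile' < 57.0008 := by
  rw [mainTermForm_taperProfile]
  have hπ := Real.pi_gt_d6
  have hπ' := Real.pi_lt_d6
  have hπ0 : 0 < π := Real.pi_pos
  constructor
  · rw [div_add' _ _ _ hπ0.ne', lt_div_iff₀ hπ0]
    nlinarith
  · rw [div_add' _ _ _ hπ0.ne', div_lt_iff₀ hπ0]
    nlinarith

end Taper

/-! ### Part 2 — the cross atoms `c₀ = π·conj(Φ_v)·L(u_T)` of the two registered designs -/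

section Cross

variable {θ : ℝ}

/-- **`c₀(u_T, v_J) = 6πh²·(−1 + πi)`**, `h = θ − 1` (`π·Φ_J·L(u_T)`, `Φ_J = h²/2`).
[cite: Zhang2022LandauSiegel, Prop 7.1 p.44, (8.11)–(8.12)] -/
theorem tailCoupling_taper_jumpProfile (hθ : 1 ≤ θ) :
    tailCoupling θ taperProfile (jumpProfile θ)
      = (((-6 * π * (θ - 1) ^ 2 : ℝ)) : ℂ) + (((6 * π ^ 2 * (θ - 1) ^ 2 : ℝ)) : ℂ) * I := by
  rw [tailCoupling, overhangMass_jumpProfile hθ, tailFunctional_taperProfile, Complex.conj_ofReal]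
  push_cast
  ring

/-- **`|c₀(u_T, v_J)|² = 36π²(1 + π²)h⁴`**, `h = θ − 1`. [cite: Zhang2022LandauSiegel, Prop 7.1 p.44, (8.11)–(8.12)] -/
theorem norm_sq_tailCoupling_taper_jumpProfile (hθ : 1 ≤ θ) :
    ‖tailCoupling θ taperProfile (jumpProfile θ)‖ ^ 2 = 36 * π ^ 2 * (1 + π ^ 2) * (θ - 1) ^ 4 := by
  rw [tailCoupling_taper_jumpProfile hθ, ← Complex.normSq_eq_norm_sq, Complex.normSq_add_mul_I]
  ring

/-- **`c₀(u_T, φ_θ) = 2πh³·(−1 + πi)`**, `h = θ − 1` (`π·Φ_A·L(u_T)`, `Φ_A = h³/6`; by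
`profBlockB_archProfile_eq_phiT` this is the arch's). [cite: Zhang2022LandauSiegel, Prop 7.1 p.44, (8.11)–(8.12)] -/
theorem tailCoupling_taper_phiT (hθ : 1 ≤ θ) :
    tailCoupling θ taperProfile (phiT θ)
      = (((-2 * π * (θ - 1) ^ 3 : ℝ)) : ℂ) + (((2 * π ^ 2 * (θ - 1) ^ 3 : ℝ)) : ℂ) * I := by
  rw [tailCoupling, overhangMass_phiT hθ, tailFunctional_taperProfile, Complex.conj_ofReal, phiInt]
  push_cast
  ring

/-- **`|c₀(u_T, φ_θ)|² = 4π²(1 + π²)h⁶`**, `h = θ − 1`. [cite: Zhang2022LandauSiegel, Prop 7.1 p.44, (8.11)–(8.12)] -/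
theorem norm_sq_tailCoupling_taper_phiT (hθ : 1 ≤ θ) :
    ‖tailCoupling θ taperProfile (phiT θ)‖ ^ 2 = 4 * π ^ 2 * (1 + π ^ 2) * (θ - 1) ^ 6 := by
  rw [tailCoupling_taper_phiT hθ, ← Complex.normSq_eq_norm_sq, Complex.normSq_add_mul_I]
  ring

end Cross

/-! ### Part 3 — the X = 0 closing criterion of `u_T ⊕ s·v_J` and `u_T ⊕ s·φ_θ` in closed form -/

section Closing

variable {θ : ℝ}

/-- **X = 0 closing criterion, jump top** (`closes_iff_of_pos` with the atoms of Parts 1–2 and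
`topDiagForm_jumpProfile_re`): the continued quadratic of `u_T ⊕ s·v_J` is negative for some amplitude `s` iff
`k₀·𝔅(u_T) < |c₀|²`, i.e. `(8h/π + 52πh³/3)·(8/π + 52π/3) < 36π²(1+π²)h⁴`, `h = θ − 1`.
[cite: Zhang2022LandauSiegel, §7 Prop 7.1 (7.2) p.44; §8 (8.11)–(8.12)] -/
theorem taper_jump_closes_iff (hθ : 1 ≤ θ) :
    (∃ s : ℂ, twoPieceMainTerm θ 0 taperProfile taperProfile' (jumpProfile θ) (jumpProfile' θ) s < 0) ↔
      (8 * (θ - 1) / π + 52 / 3 * π * (θ - 1) ^ 3) * (8 / π + 52 / 3 * π)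
        < 36 * π ^ 2 * (1 + π ^ 2) * (θ - 1) ^ 4 := by
  rw [closes_iff_of_pos mainTermForm_taperProfile_pos, overhangConst_zero, crossCoeff_zero,
    topDiagForm_jumpProfile_re hθ, mainTermForm_taperProfile, norm_sq_tailCoupling_taper_jumpProfile hθ]

/-- **X = 0 closing criterion, arch top** (`φ_θ = (x−1)(θ−x)` beyond the wall; `topDiagForm_phiT_re`): the continued
quadratic of `u_T ⊕ s·φ_θ` is negative for some `s` iff `(8h³/(3π) + 44πh⁵/15)·(8/π + 52π/3) < 4π²(1+π²)h⁶`.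
[cite: Zhang2022LandauSiegel, §7 Prop 7.1 (7.2) p.44; §8 (8.11)–(8.12)] -/
theorem taper_phiT_closes_iff (hθ : 1 ≤ θ) :
    (∃ s : ℂ, twoPieceMainTerm θ 0 taperProfile taperProfile' (phiT θ) (phiT' θ) s < 0) ↔
      (8 * (θ - 1) ^ 3 / (3 * π) + 44 / 15 * π * (θ - 1) ^ 5) * (8 / π + 52 / 3 * π)
        < 4 * π ^ 2 * (1 + π ^ 2) * (θ - 1) ^ 6 := by
  rw [closes_iff_of_pos mainTermForm_taperProfile_pos, overhangConst_zero, crossCoeff_zero,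
    topDiagForm_phiT_re hθ, mainTermForm_taperProfile, norm_sq_tailCoupling_taper_phiT hθ]

/-- Polynomial form of the jump criterion (denominators `9π²` cleared, one `h` divided out): for `θ > 1`,
closing ⇔ `(24 + 52π²h²)(24 + 52π²) < 324π⁴(1+π²)h³`. [cite: Zhang2022LandauSiegel, §7 Prop 7.1 (7.2) p.44] -/
theorem taper_jump_closes_iff' (hθ : 1 < θ) :
    (∃ s : ℂ, twoPieceMainTerm θ 0 taperProfile taperProfile' (jumpProfile θ) (jumpProfile' θ) s < 0) ↔
      (24 + 52 * π ^ 2 * (θ - 1) ^ 2) * (24 + 52 * π ^ 2) < 324 * π ^ 4 * (1 + π ^ 2) * (θ - 1) ^ 3 := by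
  rw [taper_jump_closes_iff hθ.le]
  have hπ : 0 < π := Real.pi_pos
  have hh : 0 < θ - 1 := by linarith
  have e1 : (8 * (θ - 1) / π + 52 / 3 * π * (θ - 1) ^ 3) * (8 / π + 52 / 3 * π)
      = ((24 + 52 * π ^ 2 * (θ - 1) ^ 2) * (24 + 52 * π ^ 2)) * ((θ - 1) / (9 * π ^ 2)) := by
    field_simp
    ring
  have e2 : 36 * π ^ 2 * (1 + π ^ 2) * (θ - 1) ^ 4
      = (324 * π ^ 4 * (1 + π ^ 2) * (θ - 1) ^ 3) * ((θ - 1) / (9 * π ^ 2)) := by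
    field_simp
    ring
  rw [e1, e2, mul_lt_mul_iff_left₀ (by positivity)]

/-- Polynomial form of the arch criterion (denominators `45π²` cleared, `h³` divided out): for `θ > 1`,
closing ⇔ `(40 + 44π²h²)(24 + 52π²) < 180π⁴(1+π²)h³`. [cite: Zhang2022LandauSiegel, §7 Prop 7.1 (7.2) p.44] -/
theorem taper_phiT_closes_iff' (hθ : 1 < θ) :
    (∃ s : ℂ, twoPieceMainTerm θ 0 taperProfile taperProfile' (phiT θ) (phiT' θ) s < 0) ↔
      (40 + 44 * π ^ 2 * (θ - 1) ^ 2) * (24 + 52 * π ^ 2) < 180 * π ^ 4 * (1 + π ^ 2) * (θ - 1) ^ 3 := by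
  rw [taper_phiT_closes_iff hθ.le]
  have hπ : 0 < π := Real.pi_pos
  have hh : 0 < θ - 1 := by linarith
  have e1 : (8 * (θ - 1) ^ 3 / (3 * π) + 44 / 15 * π * (θ - 1) ^ 5) * (8 / π + 52 / 3 * π)
      = ((40 + 44 * π ^ 2 * (θ - 1) ^ 2) * (24 + 52 * π ^ 2)) * ((θ - 1) ^ 3 / (45 * π ^ 2)) := by
    field_simp
    ring
  have e2 : 4 * π ^ 2 * (1 + π ^ 2) * (θ - 1) ^ 6
      = (180 * π ^ 4 * (1 + π ^ 2) * (θ - 1) ^ 3) * ((θ - 1) ^ 3 / (45 * π ^ 2)) := by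
    field_simp
    ring
  rw [e1, e2, mul_lt_mul_iff_left₀ (by positivity)]

/-- The closing sets are UP-SETS: if `A + B·h₀² < C·h₀³` with `A ≥ 0`, `C > 0`, then the same holds at every
`h ≥ h₀ > 0` (the quotient `A/h³ + B/h` is decreasing). [folklore] -/
private theorem cubic_upset {A B C h₀ h : ℝ} (hA : 0 ≤ A) (hC : 0 < C) (hh₀ : 0 < h₀) (hle : h₀ ≤ h)
    (h0 : A + B * h₀ ^ 2 < C * h₀ ^ 3) : A + B * h ^ 2 < C * h ^ 3 := by
  have hh : 0 < h := lt_of_lt_of_le hh₀ hle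
  have hB : B < C * h₀ := by
    by_contra hcon
    push Not at hcon
    have : C * h₀ ^ 3 ≤ B * h₀ ^ 2 := by nlinarith [sq_nonneg h₀, mul_le_mul_of_nonneg_right hcon (sq_nonneg h₀)]
    linarith
  have hfac : 0 ≤ (h - h₀) * (C * (h ^ 2 + h * h₀ + h₀ ^ 2) - B * (h + h₀)) := by
    refine mul_nonneg (sub_nonneg.2 hle) (le_of_lt ?_)
    nlinarith [mul_pos (sub_pos.2 hB) (add_pos hh hh₀), mul_pos hC (pow_pos hh 2)]
  nlinarith [hfac]

/-- **Up-set, jump top**: if `u_T ⊕ s·v_J` closes at `X = 0` for `θ₀ > 1`, it closes for every `θ ≥ θ₀`.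
[cite: Zhang2022LandauSiegel, §7 Prop 7.1 (7.2) p.44] -/
theorem taper_jump_closes_mono {θ₀ θ : ℝ} (hθ₀ : 1 < θ₀) (hle : θ₀ ≤ θ)
    (h0 : ∃ s : ℂ, twoPieceMainTerm θ₀ 0 taperProfile taperProfile' (jumpProfile θ₀) (jumpProfile' θ₀) s < 0) :
    ∃ s : ℂ, twoPieceMainTerm θ 0 taperProfile taperProfile' (jumpProfile θ) (jumpProfile' θ) s < 0 := by
  have hθ : 1 < θ := lt_of_lt_of_le hθ₀ hle
  rw [taper_jump_closes_iff' hθ₀] at h0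
  rw [taper_jump_closes_iff' hθ]
  have hπ : 0 < π := Real.pi_pos
  have key := cubic_upset (A := 24 * (24 + 52 * π ^ 2)) (B := 52 * π ^ 2 * (24 + 52 * π ^ 2))
    (C := 324 * π ^ 4 * (1 + π ^ 2)) (h₀ := θ₀ - 1) (h := θ - 1) (by positivity) (by positivity)
    (by linarith) (by linarith) (by linarith [h0])
  linarith [key]

/-- **Up-set, arch top**: if `u_T ⊕ s·φ_θ` closes at `X = 0` for `θ₀ > 1`, it closes for every `θ ≥ θ₀`.
[cite: Zhang2022LandauSiegel, §7 Prop 7.1 (7.2) p.44] -/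
theorem taper_phiT_closes_mono {θ₀ θ : ℝ} (hθ₀ : 1 < θ₀) (hle : θ₀ ≤ θ)
    (h0 : ∃ s : ℂ, twoPieceMainTerm θ₀ 0 taperProfile taperProfile' (phiT θ₀) (phiT' θ₀) s < 0) :
    ∃ s : ℂ, twoPieceMainTerm θ 0 taperProfile taperProfile' (phiT θ) (phiT' θ) s < 0 := by
  have hθ : 1 < θ := lt_of_lt_of_le hθ₀ hle
  rw [taper_phiT_closes_iff' hθ₀] at h0
  rw [taper_phiT_closes_iff' hθ]
  have hπ : 0 < π := Real.pi_pos
  have key := cubic_upset (A := 40 * (24 + 52 * π ^ 2)) (B := 44 * π ^ 2 * (24 + 52 * π ^ 2))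
    (C := 180 * π ^ 4 * (1 + π ^ 2)) (h₀ := θ₀ - 1) (h := θ - 1) (by positivity) (by positivity)
    (by linarith) (by linarith) (by linarith [h0])
  linarith [key]

end Closing

/-! ### Part 4 — the registered sign table (bed-7 SP2) and the thresholds `θ*` as kernel windows -/

section SignTable

/-- Powers of `π` between the six-digit bounds (crude interval arithmetic for the sign table). [folklore] -/
private theorem pi_pow_bounds :
    3.141592 ^ 2 < π ^ 2 ∧ π ^ 2 < 3.141593 ^ 2 ∧ 3.141592 ^ 4 < π ^ 4 ∧ π ^ 4 < 3.141593 ^ 4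
      ∧ 3.141592 ^ 6 < π ^ 6 ∧ π ^ 6 < 3.141593 ^ 6 := by
  have h1 := Real.pi_gt_d6
  have h2 := Real.pi_lt_d6
  have h0 : (0:ℝ) ≤ 3.141592 := by norm_num
  have hπ : 0 ≤ π := Real.pi_pos.le
  refine ⟨?_, ?_, ?_, ?_, ?_, ?_⟩
  · exact pow_lt_pow_left₀ h1 h0 (by norm_num)
  · exact pow_lt_pow_left₀ h2 hπ (by norm_num)
  · exact pow_lt_pow_left₀ h1 h0 (by norm_num)
  · exact pow_lt_pow_left₀ h2 hπ (by norm_num)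
  · exact pow_lt_pow_left₀ h1 h0 (by norm_num)
  · exact pow_lt_pow_left₀ h2 hπ (by norm_num)

/-- **SP2, jump at `θ = 2`: the X = 0 design `u_T ⊕ s·v_2` CLOSES** (`m_X0(v_J, 2) = −0.189 < 0`; `θ = 2 > θ*_J`).
[cite: Zhang2022LandauSiegel, §7 Prop 7.1 (7.2) p.44] -/
theorem taper_jump_closes_two :
    ∃ s : ℂ, twoPieceMainTerm 2 0 taperProfile taperProfile' (jumpProfile 2) (jumpProfile' 2) s < 0 := by
  rw [taper_jump_closes_iff' (by norm_num)]
  obtain ⟨h2l, h2u, h4l, h4u, h6l, h6u⟩ := pi_pow_bounds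
  norm_num at h2l h2u h4l h4u h6l h6u ⊢
  nlinarith [h2l, h2u, h4l, h4u, h6l, h6u]

/-- **SP2, jump at `θ = 3`: CLOSES** (`m_X0(v_J, 3) = −11.29`). [cite: Zhang2022LandauSiegel, §7 Prop 7.1 (7.2) p.44] -/
theorem taper_jump_closes_three :
    ∃ s : ℂ, twoPieceMainTerm 3 0 taperProfile taperProfile' (jumpProfile 3) (jumpProfile' 3) s < 0 :=
  taper_jump_closes_mono (by norm_num) (by norm_num) taper_jump_closes_two

/-- **SP2, jump at `θ = 3/2`: does NOT close** (`m_X0(v_J, 3/2) = +0.067`; `3/2 < θ*_J`).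
[cite: Zhang2022LandauSiegel, §7 Prop 7.1 (7.2) p.44] -/
theorem taper_jump_not_closes_three_halves :
    ¬ ∃ s : ℂ, twoPieceMainTerm (3/2) 0 taperProfile taperProfile' (jumpProfile (3/2)) (jumpProfile' (3/2)) s < 0 := by
  rw [taper_jump_closes_iff' (by norm_num), not_lt]
  obtain ⟨h2l, h2u, h4l, h4u, h6l, h6u⟩ := pi_pow_bounds
  norm_num at h2l h2u h4l h4u h6l h6u ⊢
  nlinarith [h2l, h2u, h4l, h4u, h6l, h6u]

/-- **SP2, jump at `θ = 5/4`: does NOT close** (`m_X0(v_J, 5/4) = +0.021`). [cite: Zhang2022LandauSiegel, §7 Prop 7.1 (7.2) p.44] -/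
theorem taper_jump_not_closes_five_quarters :
    ¬ ∃ s : ℂ, twoPieceMainTerm (5/4) 0 taperProfile taperProfile' (jumpProfile (5/4)) (jumpProfile' (5/4)) s < 0 := by
  intro h
  exact taper_jump_not_closes_three_halves (taper_jump_closes_mono (by norm_num) (by norm_num) h)

/-- **SP2, arch at `θ = 3`: the X = 0 design `u_T ⊕ s·φ_3` CLOSES** (`m_X0(v_A, 3) = −3.16`; `3 > θ*_A`).
[cite: Zhang2022LandauSiegel, §7 Prop 7.1 (7.2) p.44] -/
theorem taper_phiT_closes_three :
    ∃ s : ℂ, twoPieceMainTerm 3 0 taperProfile taperProfile' (phiT 3) (phiT' 3) s < 0 := by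
  rw [taper_phiT_closes_iff' (by norm_num)]
  obtain ⟨h2l, h2u, h4l, h4u, h6l, h6u⟩ := pi_pow_bounds
  norm_num at h2l h2u h4l h4u h6l h6u ⊢
  nlinarith [h2l, h2u, h4l, h4u, h6l, h6u]

/-- **SP2, arch at `θ = 2`: does NOT close** (`m_X0(v_A, 2) = +0.044`; `2 < θ*_A` — the arch self term outweighs
the smaller mass `Φ_A = h³/6`). [cite: Zhang2022LandauSiegel, §7 Prop 7.1 (7.2) p.44] -/
theorem taper_phiT_not_closes_two :
    ¬ ∃ s : ℂ, twoPieceMainTerm 2 0 taperProfile taperProfile' (phiT 2) (phiT' 2) s < 0 := by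
  rw [taper_phiT_closes_iff' (by norm_num), not_lt]
  obtain ⟨h2l, h2u, h4l, h4u, h6l, h6u⟩ := pi_pow_bounds
  norm_num at h2l h2u h4l h4u h6l h6u ⊢
  nlinarith [h2l, h2u, h4l, h4u, h6l, h6u]

/-- **SP2, arch at `θ = 3/2`: does NOT close** (`m_X0(v_A, 3/2) = +0.0049`). [cite: Zhang2022LandauSiegel, §7 Prop 7.1 (7.2) p.44] -/
theorem taper_phiT_not_closes_three_halves :
    ¬ ∃ s : ℂ, twoPieceMainTerm (3/2) 0 taperProfile taperProfile' (phiT (3/2)) (phiT' (3/2)) s < 0 := by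
  intro h
  exact taper_phiT_not_closes_two (taper_phiT_closes_mono (by norm_num) (by norm_num) h)

/-- **SP2, arch at `θ = 5/4`: does NOT close** (`m_X0(v_A, 5/4) = +0.00036`). [cite: Zhang2022LandauSiegel, §7 Prop 7.1 (7.2) p.44] -/
theorem taper_phiT_not_closes_five_quarters :
    ¬ ∃ s : ℂ, twoPieceMainTerm (5/4) 0 taperProfile taperProfile' (phiT (5/4)) (phiT' (5/4)) s < 0 := by
  intro h
  exact taper_phiT_not_closes_two (taper_phiT_closes_mono (by norm_num) (by norm_num) h)

/-- **`θ*_J < 1.856`**: the jump design closes at every `θ ≥ 1.856`. [cite: Zhang2022LandauSiegel, §7 Prop 7.1 (7.2) p.44] -/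
theorem taper_jump_closes_of_ge {θ : ℝ} (hθ : 1.856 ≤ θ) :
    ∃ s : ℂ, twoPieceMainTerm θ 0 taperProfile taperProfile' (jumpProfile θ) (jumpProfile' θ) s < 0 := by
  refine taper_jump_closes_mono (θ₀ := 1.856) (by norm_num) hθ ?_
  rw [taper_jump_closes_iff' (by norm_num)]
  obtain ⟨h2l, h2u, h4l, h4u, h6l, h6u⟩ := pi_pow_bounds
  norm_num at h2l h2u h4l h4u h6l h6u ⊢
  nlinarith [h2l, h2u, h4l, h4u, h6l, h6u]

/-- **`1.855 < θ*_J`**: the jump design does not close at any `1 < θ ≤ 1.855` (with the two previous theorems: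
`θ*_J ∈ (1.855, 1.856)`; bed-7 printed `1.8551`). [cite: Zhang2022LandauSiegel, §7 Prop 7.1 (7.2) p.44] -/
theorem taper_jump_not_closes_of_le {θ : ℝ} (hθ1 : 1 < θ) (hθ : θ ≤ 1.855) :
    ¬ ∃ s : ℂ, twoPieceMainTerm θ 0 taperProfile taperProfile' (jumpProfile θ) (jumpProfile' θ) s < 0 := by
  intro h
  have h' := taper_jump_closes_mono hθ1 hθ h
  rw [taper_jump_closes_iff' (by norm_num)] at h'
  obtain ⟨h2l, h2u, h4l, h4u, h6l, h6u⟩ := pi_pow_bounds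
  norm_num at h2l h2u h4l h4u h6l h6u h'
  nlinarith [h2l, h2u, h4l, h4u, h6l, h6u, h']

/-- **`θ*_A < 2.292`**: the arch design closes at every `θ ≥ 2.292`. [cite: Zhang2022LandauSiegel, §7 Prop 7.1 (7.2) p.44] -/
theorem taper_phiT_closes_of_ge {θ : ℝ} (hθ : 2.292 ≤ θ) :
    ∃ s : ℂ, twoPieceMainTerm θ 0 taperProfile taperProfile' (phiT θ) (phiT' θ) s < 0 := by
  refine taper_phiT_closes_mono (θ₀ := 2.292) (by norm_num) hθ ?_
  rw [taper_phiT_closes_iff' (by norm_num)]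
  obtain ⟨h2l, h2u, h4l, h4u, h6l, h6u⟩ := pi_pow_bounds
  norm_num at h2l h2u h4l h4u h6l h6u ⊢
  nlinarith [h2l, h2u, h4l, h4u, h6l, h6u]

/-- **`2.291 < θ*_A`**: the arch design does not close at any `1 < θ ≤ 2.291` (so `θ*_A ∈ (2.291, 2.292)`; bed-7
printed `2.2917`). [cite: Zhang2022LandauSiegel, §7 Prop 7.1 (7.2) p.44] -/
theorem taper_phiT_not_closes_of_le {θ : ℝ} (hθ1 : 1 < θ) (hθ : θ ≤ 2.291) :
    ¬ ∃ s : ℂ, twoPieceMainTerm θ 0 taperProfile taperProfile' (phiT θ) (phiT' θ) s < 0 := by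
  intro h
  have h' := taper_phiT_closes_mono hθ1 hθ h
  rw [taper_phiT_closes_iff' (by norm_num)] at h'
  obtain ⟨h2l, h2u, h4l, h4u, h6l, h6u⟩ := pi_pow_bounds
  norm_num at h2l h2u h4l h4u h6l h6u h'
  nlinarith [h2l, h2u, h4l, h4u, h6l, h6u, h']

end SignTable

/-! ### Part 6 — the kernel-mode rows `u_K = g⋆` (`𝔅(g⋆) = 0`, `Repair.mainTermForm_gStar`): at X = 0 the design
`g⋆ ⊕ s·v` closes at EVERY `θ > 1` for both registered tops, because the tail coupling `c₀ = π·Φ_v·L(g⋆) = 24πΦ_v` is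
nonzero (`closes_iff_of_zero`; bed-7 spec §2 «for u_K (a = 0) the X = 0 block is indefinite at every θ > 1», the
`uKThreshold` rows `m_K*(v,θ) = |24πΦ_v|²/k₀` of `RepairBedLenxClosedForms` being the uu-slot restoration levels) -/

section KernelMode

variable {θ : ℝ}

/-- **Kernel-mode row, jump top**: `g⋆ ⊕ s·v_J` closes at X = 0 for every `θ > 1` (`c₀ = 12πh² ≠ 0`).
[cite: Zhang2022LandauSiegel, §7 Prop 7.1 (7.2) p.44; §8 (8.11)–(8.12)] -/
theorem gStar_jump_closes (hθ : 1 < θ) :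
    ∃ s : ℂ, twoPieceMainTerm θ 0 gStar gStar' (jumpProfile θ) (jumpProfile' θ) s < 0 := by
  rw [closes_iff_of_zero mainTermForm_gStar, crossCoeff_zero]
  left
  rw [tailCoupling, crossModel_gStar_jumpProfile hθ.le, Complex.ofReal_ne_zero]
  have : 0 < θ - 1 := by linarith
  positivity

/-- **Kernel-mode row, arch top**: `g⋆ ⊕ s·φ_θ` closes at X = 0 for every `θ > 1` (`c₀ = 4πh³ ≠ 0`; cf.
`Repair.inRplus_gStar_phiT` / `KnifeEdge.jointCloses_zero` for the same design in the class books).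
[cite: Zhang2022LandauSiegel, §7 Prop 7.1 (7.2) p.44; §8 (8.11)–(8.12)] -/
theorem gStar_phiT_closes (hθ : 1 < θ) :
    ∃ s : ℂ, twoPieceMainTerm θ 0 gStar gStar' (phiT θ) (phiT' θ) s < 0 := by
  rw [closes_iff_of_zero mainTermForm_gStar, crossCoeff_zero]
  left
  rw [tailCoupling, overhangMass_phiT hθ.le, tailFunctional_gStar, Complex.conj_ofReal, phiInt]
  have e : (π : ℂ) * ((((θ - 1) ^ 3 / 6 : ℝ)) : ℂ) * 24 = (((π * ((θ - 1) ^ 3 / 6) * 24 : ℝ)) : ℂ) := by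
    push_cast
    ring
  rw [e, Complex.ofReal_ne_zero]
  have : 0 < θ - 1 := by linarith
  positivity

end KernelMode

end Literature.NumberTheory.LFunctions.Zhang2022.Repair.Bed
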